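/-
Copyright (c) 2026 the pub-hodgecm-mathlib formalisation cell (harness21).  Prover seat hodgecm-mathlib-F0P2-p11 (g2) (L1; LEAD F0P6-plan (g14) «(o1) KIND 1», memo
`CENSUS-K1-DealTable` ADDENDUM «TWIN»), Track B «K2-LIT» ∕ hLiu418 #184♮, ROAD Φ, G5-b: THE `inl` TWIN OF (T4) — the other enumeration `e (1, 0) = 0`, where the corner
index `1` is the FIRST summand `V₁` and the chart is `x ↦ blkD (x, 1)`.  THEOREMS ONLY.
-/
import Summits.HodgeConjecture.HodgeConjecture.Theorems.K2LiuLineCornerChart       -- ★ p862662 (+ ★ p862584, ★ p862538, ★ p862495, ★ `blkD`)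
import Summits.HodgeConjecture.HodgeConjecture.Theorems.K2LiuCornerLineWhittaker   -- ★ p862629 ((T4-β) core, `inr`)
import HarnessLib

/-!
# Crux `HLiu418`, KIND 1, (T4) `inl` twin: under `e (1, 0) = 0` the corner of the rank-one files is the `V₁`-summand — `w₀ = blkD (w_Δ⁽ᴬ⁾, 1)`, `n₂ t = blkD (nA t, 1)`,
# and the corner-line integral is `whittakerDelta` of the doubled line `H(V₁)` for `x ↦ f (blkD (x, 1) · g)`

Cell `hodgecm-mathlib`, crux item hLiu418 = `stmt-HodgeConjecture-24832` (helper lane, count-neutral); squad K2 ∕ K2Liu, LEAD F0P6-plan (g14); prover F0P2-p11 (g2).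
THEOREMS ONLY (no `def`, no `instance`, no notation, no named-fact hypothesis, no `sorry`).

The TOP fixes an arbitrary enumeration `e : Fin 2 × Fin 1 ≃ Fin n`; there are two.  ★ p862584 ∕ p862629 ∕ p862662 §2 treat `e (1, 0) = 1` (corner = `V₂`, chart `blkD (1, ·)`); this file is the
token-for-token twin for `e (1, 0) = 0` (corner = `V₁`, chart `blkD (·, 1)`), over the `inl` heads already ★ (p862495 `isSiegelDeltaSection_comp_blkD_inl` — shift `s + n₂∕2 = s + ½`;
p862538 `blk_blkD_inl_one_toBlocks₁₂`, `blkD_inl_one_mem_unipDelta`, `unipDeltaChar_blkD_inl_one`) and the datum-generic ★ p862662 §1 `exists_lineChart` ∕ ★ p862728 (served by the line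
datum `(eA, dA, dW)` verbatim).
* §1 `apply_zero_eq_one`, `idxSplit_one'`, `idxSplit_zero'`, `reindex_symm_fromBlocks_two'` — `σ 1 = inl a`, `σ 0 = inr b`, `σ⁻¹(A ⊕ D) = !![D b b, 0; 0, A a a]`.
* §2 **`blk_blkD_inl_one_toBlocks₁₂_two`** — `(blk (blkD (x, 1)))₁₂ = single 1 1 (X(x) a a)`; **`iotaGG_one_eq_blkD_weylDelta_inl`** — `ι(1, g₀) = blkD (w_Δ⁽ᴬ⁾, 1)`.
* §3 **`cornerLine_integral_eq_whittakerDelta_line_inl`** (+ `_levi`) — `∫ conj ψ_S(n₂ t) f(w₀ (n₂ t g)) dμ = whittakerDelta⁽ᴬ⁾ (nA_* μ) S₁₁ (fun x => f (blkD (x, 1) g)) 1`.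
* §4 **`cornerLine_eq_blkD_lineChart_inl`** — `n₂ t = blkD (nA t, 1)` for any line chart `nA` of ★ p862662's shape on `(eA, dA, dW)`.
HONEST LABEL.  Count-neutral helper; `HC_CM` is proved only modulo the 7 printed citations (2 remaining named inputs: hLiu418 = `stmt-HodgeConjecture-24832`,
h413 = `stmt-HodgeConjecture-24833`) until rung 0 closes.

## References
* [KudlaRallis1994] S. Kudla, S. Rallis, Ann. of Math. 140 (1994), §2 (2.10)–(2.12).
* [Kudla1994] S. Kudla, Israel J. Math. 87 (1994), §2, Thm. 3.1.
* [MoeglinWaldspurger1995] C. Mœglin, J.-L. Waldspurger, CUP (1995), II.1.7.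
* [GelbartPiatetskishapiroRallis1987] LNM 1254 (1987), Part A §1–§2.
-/

set_option autoImplicit false
set_option linter.dupNamespace false -- the mandated namespace repeats `HodgeConjecture.HodgeConjecture`

noncomputable section

open scoped Matrix ComplexConjugate
open NumberField IsDedekindDomain MeasureTheory
open Literature.NumberTheory.Automorphic Literature.NumberTheory.Automorphic.UnitaryGroup Literature.NumberTheory.GaloisRepresentations
open Literature.NumberTheory.GelbartRogawski1991 Literature.NumberTheory.GelbartRogawski1991.GRConstruction
open Literature.NumberTheory.K2Lit.SiegelDoubled
open UnitaryDualPair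

namespace Summit.HodgeConjecture.HodgeConjecture.Cruxes.HLiu418.K2LiuCornerLineChartTwoInl

open K2LiuSiegelUnipotentFourierDefs K2LiuSiegelUnipotentCharacters K2LiuBlockDiagUnipotentChart K2LiuCornerLineChartTwo K2LiuCornerLineWhittaker

variable (L : Type) [Field L] [NumberField L] [IsCMField L]
variable {n₁ n₂ : ℕ} (e : Fin (1 + 1) × Fin 1 ≃ Fin 2) (eA : Fin 1 × Fin 1 ≃ Fin n₁) (eB : Fin 1 × Fin 1 ≃ Fin n₂)
  (dA : Fin 1 → L) (hdA : ∀ i, IsCMField.complexConj L (dA i) = dA i)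
  (dB : Fin 1 → L) (hdB : ∀ i, IsCMField.complexConj L (dB i) = dB i)
  (dV : Fin (1 + 1) → L) (hdV : ∀ i, IsCMField.complexConj L (dV i) = dV i)
  (hVA : ∀ i, dV (Fin.castAdd 1 i) = dA i) (hVB : ∀ j, dV (Fin.natAdd 1 j) = dB j)
  (dW : Fin 1 → L) (hdW : ∀ i, IsCMField.complexConj L (dW i) = dW i)

/-! ## §1 The see-saw enumeration under `e (1, 0) = 0` -/

omit [NumberField L] [IsCMField L] in
include e in
/-- under `e (1, 0) = 0` the first basis vector sits at index `1`. [folklore] -/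
theorem apply_zero_eq_one (he : e (1, 0) = 0) : e (0, 0) = 1 := by
  have hne : e (0, 0) ≠ 0 := fun h => by
    have := e.injective (h.trans he.symm)
    simp at this
  generalize e (0, 0) = i at hne ⊢
  fin_cases i
  · exact absurd rfl hne
  · rfl

omit [NumberField L] [IsCMField L] in
/-- **`σ 1 = inl a`**, `a = eA (0,0)`: the corner index `1 : Fin 2` is the `V₁`-summand (★ `eV_symm_idxSplit_symm_inl`). [cite: Kudla1994, §2] -/
theorem idxSplit_one' (he : e (1, 0) = 0) : idxSplit e eA eB 1 = Sum.inl (eA (0, 0)) := by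
  have h := eV_symm_idxSplit_symm_inl e eA eB (eA (0, 0))
  rw [Equiv.symm_apply_apply] at h
  have h' : (idxSplit e eA eB).symm (Sum.inl (eA (0, 0))) = 1 := by
    rw [← apply_zero_eq_one e he, ← e.apply_symm_apply ((idxSplit e eA eB).symm (Sum.inl (eA (0, 0)))), h]
    rfl
  rw [← h', Equiv.apply_symm_apply]

omit [NumberField L] [IsCMField L] in
/-- **`σ 0 = inr b`**, `b = eB (0,0)` (★ `eV_symm_idxSplit_symm_inr`). [cite: Kudla1994, §2] -/
theorem idxSplit_zero' (he : e (1, 0) = 0) : idxSplit e eA eB 0 = Sum.inr (eB (0, 0)) := by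
  have h := eV_symm_idxSplit_symm_inr e eA eB (eB (0, 0))
  rw [Equiv.symm_apply_apply] at h
  have h' : (idxSplit e eA eB).symm (Sum.inr (eB (0, 0))) = 0 := by
    rw [← he, ← e.apply_symm_apply ((idxSplit e eA eB).symm (Sum.inr (eB (0, 0)))), h]
    rfl
  rw [← h', Equiv.apply_symm_apply]

omit [NumberField L] [IsCMField L] in
/-- the see-saw re-enumeration of a block sum under `e (1,0) = 0`, entrywise: `σ⁻¹(A ⊕ D) = diag(D b b, A a a)`. [cite: Kudla1994, §2] -/
theorem reindex_symm_fromBlocks_two' {R : Type*} [Zero R] (he : e (1, 0) = 0) (A : Matrix (Fin n₁) (Fin n₁) R) (D : Matrix (Fin n₂) (Fin n₂) R) :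
    Matrix.reindex (idxSplit e eA eB).symm (idxSplit e eA eB).symm (Matrix.fromBlocks A 0 0 D) =
      !![D (eB (0, 0)) (eB (0, 0)), 0; 0, A (eA (0, 0)) (eA (0, 0))] := by
  ext i j
  simp only [Matrix.reindex_apply, Matrix.submatrix_apply, Equiv.symm_symm]
  fin_cases i <;> fin_cases j <;>
    simp [idxSplit_one' e eA eB he, idxSplit_zero' e eA eB he, Matrix.fromBlocks_apply₁₁, Matrix.fromBlocks_apply₁₂, Matrix.fromBlocks_apply₂₁,
      Matrix.fromBlocks_apply₂₂]

/-! ## §2 The corner coordinate and the Weyl element along `blkD (·, 1)` -/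

/-- **`(blk (blkD (x, 1)))₁₂ = single 1 1 (X(x) a a)`**, `a = eA (0,0)` (★ p862538 `blk_blkD_inl_one_toBlocks₁₂` + §1). [cite: KudlaRallis1994, §2 (2.10)–(2.12)] [cite: Kudla1994, §2] -/
theorem blk_blkD_inl_one_toBlocks₁₂_two (he : e (1, 0) = 0) (x : HA L eA dA hdA dW hdW) :
    (blk L e dV hdV dW hdW (blkD L e eA eB dA hdA dB hdB dV hdV hVA hVB dW hdW (x, 1))).toBlocks₁₂ =
      Matrix.single (1 : Fin 2) (1 : Fin 2) ((blk L eA dA hdA dW hdW x).toBlocks₁₂ (eA (0, 0)) (eA (0, 0))) := by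
  rw [blk_blkD_inl_one_toBlocks₁₂, reindex_symm_fromBlocks_two' e eA eB he]
  ext i j
  fin_cases i <;> fin_cases j <;> simp [Matrix.single]

/-- **`ι(1, g₀) = blkD (w_Δ⁽ᴬ⁾, 1)`** at `n = 2` under `e (1, 0) = 0`. [cite: GelbartPiatetskishapiroRallis1987, Part A §1–§2] [cite: KudlaRallis1994, §2 (2.10)–(2.12)] [cite: Kudla1994, §2] -/
theorem iotaGG_one_eq_blkD_weylDelta_inl (he : e (1, 0) = 0)
    {g₀ : UnitaryGroup.rationalPair (Fp L) L (IsCMField.complexConj L) (1 + 1) 1 (Matrix.diagonal dV) (Matrix.diagonal dW)}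
    (hg₀ : ((g₀ : GL (Fin (1 + 1) × Fin 1) L) : Matrix (Fin (1 + 1) × Fin 1) (Fin (1 + 1) × Fin 1) L) =
      Matrix.diagonal (fun k => 1 - 2 * (![0, 1] : Fin 2 → L) (e k))) :
    iotaGG L e dV hdV dW hdW (1, UnitaryGroup.rationalPairToAdelic (Fp L) L (IsCMField.complexConj L) (1 + 1) 1 (Matrix.diagonal dV) (Matrix.diagonal dW) g₀) =
      blkD L e eA eB dA hdA dB hdB dV hdV hVA hVB dW hdW (weylDelta L eA dA hdA dW hdW, 1) := by
  refine eq_of_blk_eq L e dV hdV dW hdW ?_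
  have h1 := blk_one_toBlocks eB dB hdB dW hdW
  have hw : (blk L eA dA hdA dW hdW (weylDelta L eA dA hdA dW hdW)).toBlocks₁₁ = 1 ∧ (blk L eA dA hdA dW hdW (weylDelta L eA dA hdA dW hdW)).toBlocks₁₂ = 0 ∧
      (blk L eA dA hdA dW hdW (weylDelta L eA dA hdA dW hdW)).toBlocks₂₁ = 0 ∧ (blk L eA dA hdA dW hdW (weylDelta L eA dA hdA dW hdW)).toBlocks₂₂ = -1 := by
    rw [blk_weylDelta, Matrix.toBlocks_fromBlocks₁₁, Matrix.toBlocks_fromBlocks₁₂, Matrix.toBlocks_fromBlocks₂₁, Matrix.toBlocks_fromBlocks₂₂]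
    exact ⟨rfl, rfl, rfl, rfl⟩
  rw [← Matrix.fromBlocks_toBlocks (blk L e dV hdV dW hdW (blkD L e eA eB dA hdA dB hdB dV hdV hVA hVB dW hdW (weylDelta L eA dA hdA dW hdW, 1))),
    blk_blkD_toBlocks₁₁, blk_blkD_toBlocks₁₂, blk_blkD_toBlocks₂₁, blk_blkD_toBlocks₂₂, h1.1, h1.2.1, h1.2.2.1, h1.2.2.2, hw.1, hw.2.1, hw.2.2.1, hw.2.2.2,
    blk_iotaGG_eq]
  simp only [reindex_symm_fromBlocks_two' e eA eB he, OneMemClass.coe_one, Units.val_one, Matrix.reindex_apply, Matrix.submatrix_one_equiv,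
    coe_rationalPairToAdelic, hg₀]
  have h12 : (1 : AdeleRing (𝓞 L) L) - 2 = -1 := by norm_num
  ext i j
  rcases i with i | i <;> rcases j with j | j <;> fin_cases i <;> fin_cases j <;>
    simp [Matrix.fromBlocks_apply₁₁, Matrix.fromBlocks_apply₁₂, Matrix.fromBlocks_apply₂₁, Matrix.fromBlocks_apply₂₂, Matrix.neg_apply, map_ofNat, h12]

/-! ## §3 The corner-line integral as `whittakerDelta` of `H(V₁)` -/

/-- `blkD (x, 1) · blkD (x', 1) = blkD (x·x', 1)`. [cite: Kudla1994, §2] -/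
theorem blkD_inl_one_mul (x x' : HA L eA dA hdA dW hdW) :
    blkD L e eA eB dA hdA dB hdB dV hdV hVA hVB dW hdW (x, 1) * blkD L e eA eB dA hdA dB hdB dV hdV hVA hVB dW hdW (x', 1) =
      blkD L e eA eB dA hdA dB hdB dV hdV hVA hVB dW hdW (x * x', 1) := by
  rw [← map_mul, Prod.mk_mul_mk, mul_one]

/-- **THE CORNER-LINE INTEGRAL IS `whittakerDelta` OF THE DOUBLED LINE `H(V₁)`** under `e (1, 0) = 0`: for a measurable line chart `nA : 𝔸_{L⁺} → N_Δ⁽ᴬ⁾(𝔸)` with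
`n₂ t = blkD (nA t, 1)`, `f` continuous: `∫ conj ψ_S(n₂ t) f(w₀ (n₂ t g)) dμ = whittakerDelta⁽ᴬ⁾ (nA_* μ) S₁₁ (fun x => f (blkD (x, 1) g)) 1`, `S₁₁ = (σ S σ⁻¹)₁₁`.
[cite: KudlaRallis1994, §2 (2.10)–(2.12)] [cite: MoeglinWaldspurger1995, II.1.7] -/
theorem cornerLine_integral_eq_whittakerDelta_line_inl (he : e (1, 0) = 0)
    {g₀ : UnitaryGroup.rationalPair (Fp L) L (IsCMField.complexConj L) (1 + 1) 1 (Matrix.diagonal dV) (Matrix.diagonal dW)}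
    (hg₀ : ((g₀ : GL (Fin (1 + 1) × Fin 1) L) : Matrix (Fin (1 + 1) × Fin 1) (Fin (1 + 1) × Fin 1) L) =
      Matrix.diagonal (fun k => 1 - 2 * (![0, 1] : Fin 2 → L) (e k)))
    [MeasurableSpace (AdeleRing (𝓞 (Fp L)) (Fp L))] (μ : Measure (AdeleRing (𝓞 (Fp L)) (Fp L)))
    [MeasurableSpace (unipDelta L eA dA hdA dW hdW)] [BorelSpace (unipDelta L eA dA hdA dW hdW)]
    (nA : AdeleRing (𝓞 (Fp L)) (Fp L) → unipDelta L eA dA hdA dW hdW) (hnA : Measurable nA)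
    (n₂ : AdeleRing (𝓞 (Fp L)) (Fp L) → HA L e dV hdV dW hdW)
    (hn₂ : ∀ t, n₂ t = blkD L e eA eB dA hdA dB hdB dV hdV hVA hVB dW hdW (((nA t : unipDelta L eA dA hdA dW hdW) : HA L eA dA hdA dW hdW), 1))
    (S : Matrix (Fin 2) (Fin 2) L) {f : HA L e dV hdV dW hdW → ℂ} (hfc : Continuous f) (g : HA L e dV hdV dW hdW) :
    ∫ t, conj (unipDeltaChar L e dV hdV dW hdW S (n₂ t) : ℂ) *
        f (iotaGG L e dV hdV dW hdW (1, UnitaryGroup.rationalPairToAdelic (Fp L) L (IsCMField.complexConj L) (1 + 1) 1 (Matrix.diagonal dV) (Matrix.diagonal dW) g₀) *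
          (n₂ t * g)) ∂μ =
      whittakerDelta L eA dA hdA dW hdW (Measure.map nA μ) ((Matrix.reindex (idxSplit e eA eB) (idxSplit e eA eB) S).toBlocks₁₁)
        (fun x => f (blkD L e eA eB dA hdA dB hdB dV hdV hVA hVB dW hdW (x, 1) * g)) 1 := by
  have h3 : Continuous fun x : unipDelta L eA dA hdA dW hdW =>
      blkD L e eA eB dA hdA dB hdB dV hdV hVA hVB dW hdW (weylDelta L eA dA hdA dW hdW * (x : HA L eA dA hdA dW hdW) * 1, 1) * g :=
    ((continuous_blkD L e eA eB dA hdA dB hdB dV hdV hVA hVB dW hdW).comp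
      (((continuous_const.mul continuous_subtype_val).mul continuous_const).prodMk continuous_const)).mul continuous_const
  have hcont : Continuous fun x : unipDelta L eA dA hdA dW hdW =>
      conj (unipDeltaChar L eA dA hdA dW hdW ((Matrix.reindex (idxSplit e eA eB) (idxSplit e eA eB) S).toBlocks₁₁) (x : HA L eA dA hdA dW hdW) : ℂ) *
        f (blkD L e eA eB dA hdA dB hdB dV hdV hVA hVB dW hdW (weylDelta L eA dA hdA dW hdW * (x : HA L eA dA hdA dW hdW) * 1, 1) * g) :=
    (Complex.continuous_conj.comp (continuous_unipDeltaChar_coe L eA dA hdA dW hdW _)).mul (hfc.comp h3)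
  rw [whittakerDelta_def, integral_map hnA.aemeasurable hcont.aestronglyMeasurable]
  refine integral_congr_ae (Filter.Eventually.of_forall fun t => ?_)
  dsimp only
  rw [hn₂ t, unipDeltaChar_blkD_inl_one, iotaGG_one_eq_blkD_weylDelta_inl L e eA eB dA hdA dB hdB dV hdV hVA hVB dW hdW he hg₀, ← mul_assoc, blkD_inl_one_mul, mul_one]

/-- the same with the Levi-conjugated character of ★ p861327 (`hψ : ψ_S(m⁻¹ u m) = ψ_{S'}(u)` on `N_Δ(𝔸)`, ★ `unipDeltaChar_conj_eq`). [cite: KudlaRallis1994, §2 (2.10)–(2.12)] [cite: MoeglinWaldspurger1995, II.1.7] -/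
theorem cornerLine_integral_eq_whittakerDelta_line_inl_levi (he : e (1, 0) = 0)
    {g₀ : UnitaryGroup.rationalPair (Fp L) L (IsCMField.complexConj L) (1 + 1) 1 (Matrix.diagonal dV) (Matrix.diagonal dW)}
    (hg₀ : ((g₀ : GL (Fin (1 + 1) × Fin 1) L) : Matrix (Fin (1 + 1) × Fin 1) (Fin (1 + 1) × Fin 1) L) =
      Matrix.diagonal (fun k => 1 - 2 * (![0, 1] : Fin 2 → L) (e k)))
    [MeasurableSpace (AdeleRing (𝓞 (Fp L)) (Fp L))] (μ : Measure (AdeleRing (𝓞 (Fp L)) (Fp L)))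
    [MeasurableSpace (unipDelta L eA dA hdA dW hdW)] [BorelSpace (unipDelta L eA dA hdA dW hdW)]
    (nA : AdeleRing (𝓞 (Fp L)) (Fp L) → unipDelta L eA dA hdA dW hdW) (hnA : Measurable nA)
    (n₂ : AdeleRing (𝓞 (Fp L)) (Fp L) → HA L e dV hdV dW hdW)
    (hn₂ : ∀ t, n₂ t = blkD L e eA eB dA hdA dB hdB dV hdV hVA hVB dW hdW (((nA t : unipDelta L eA dA hdA dW hdW) : HA L eA dA hdA dW hdW), 1))
    (S S' : Matrix (Fin 2) (Fin 2) L) (m : HA L e dV hdV dW hdW)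
    (hψ : ∀ u : HA L e dV hdV dW hdW, u ∈ unipDelta L e dV hdV dW hdW → unipDeltaChar L e dV hdV dW hdW S (m⁻¹ * u * m) = unipDeltaChar L e dV hdV dW hdW S' u)
    {f : HA L e dV hdV dW hdW → ℂ} (hfc : Continuous f) (g : HA L e dV hdV dW hdW) :
    ∫ t, conj (unipDeltaChar L e dV hdV dW hdW S (m⁻¹ * n₂ t * m) : ℂ) *
        f (iotaGG L e dV hdV dW hdW (1, UnitaryGroup.rationalPairToAdelic (Fp L) L (IsCMField.complexConj L) (1 + 1) 1 (Matrix.diagonal dV) (Matrix.diagonal dW) g₀) *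
          (n₂ t * g)) ∂μ =
      whittakerDelta L eA dA hdA dW hdW (Measure.map nA μ) ((Matrix.reindex (idxSplit e eA eB) (idxSplit e eA eB) S').toBlocks₁₁)
        (fun x => f (blkD L e eA eB dA hdA dB hdB dV hdV hVA hVB dW hdW (x, 1) * g)) 1 := by
  have hmem : ∀ t, n₂ t ∈ unipDelta L e dV hdV dW hdW := fun t => by
    rw [hn₂ t]
    exact blkD_inl_one_mem_unipDelta L e eA eB dA hdA dB hdB dV hdV hVA hVB dW hdW (nA t).2
  simp_rw [hψ _ (hmem _)]
  exact cornerLine_integral_eq_whittakerDelta_line_inl L e eA eB dA hdA dB hdB dV hdV hVA hVB dW hdW he hg₀ μ nA hnA n₂ hn₂ S' hfc g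

/-! ## §4 The corner line is `blkD (nA ·, 1)` -/

/-- **`n₂ t = blkD (nA t, 1)`** under `e (1, 0) = 0`, for any line chart `nA` on `(eA, dA, dW)` of ★ p862662's shape and any corner line `n₂` of ★ p861153's shape.
[cite: KudlaRallis1994, §2 (2.10)–(2.12)] [cite: Kudla1994, §2] -/
theorem cornerLine_eq_blkD_lineChart_inl (he : e (1, 0) = 0)
    (nA : AdeleRing (𝓞 (Fp L)) (Fp L) → unipDelta L eA dA hdA dW hdW)
    (hnA : ∀ t, (blk L eA dA hdA dW hdW (nA t : HA L eA dA hdA dW hdW)).toBlocks₁₂ =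
      Matrix.of fun _ _ => AdeleRing.baseChange (Fp L) L t * algebraMap L (AdeleRing (𝓞 L) L) (imagUnit L))
    (n₂ : AdeleRing (𝓞 (Fp L)) (Fp L) → HA L e dV hdV dW hdW) (hn₂mem : ∀ t, n₂ t ∈ unipDelta L e dV hdV dW hdW)
    (hn₂X : ∀ t, (blk L e dV hdV dW hdW (n₂ t)).toBlocks₁₂ =
      Matrix.single (1 : Fin 2) (1 : Fin 2) (AdeleRing.baseChange (Fp L) L t * algebraMap L (AdeleRing (𝓞 L) L) (imagUnit L)))
    (t : AdeleRing (𝓞 (Fp L)) (Fp L)) :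
    n₂ t = blkD L e eA eB dA hdA dB hdB dV hdV hVA hVB dW hdW (((nA t : unipDelta L eA dA hdA dW hdW) : HA L eA dA hdA dW hdW), 1) := by
  refine eq_of_mem_unipDelta_of_toBlocks₁₂_eq L e dV hdV dW hdW (hn₂mem t)
    (blkD_inl_one_mem_unipDelta L e eA eB dA hdA dB hdB dV hdV hVA hVB dW hdW (nA t).2) ?_
  rw [hn₂X, blk_blkD_inl_one_toBlocks₁₂_two L e eA eB dA hdA dB hdB dV hdV hVA hVB dW hdW he, hnA]
  rfl

end Summit.HodgeConjecture.HodgeConjecture.Cruxes.HLiu418.K2LiuCornerLineChartTwoInl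

end
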